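import Mathlib
import HarnessLib
import Summits.Ventures.LatticeQCDFlow.Exactness.LatticeSitePolynomialOperator
import Summits.Ventures.LatticeQCDFlow.Exactness.SphereLatticePoissonSolver

/-!
# The spectrum of Lüscher's operator `−Σ_k ∂̃_k·∂̃_k` on lattice polynomials of degree `≤ N`: every eigenvalue is a label `Σ_n c_n (c_n + d − 2)`, hence `0` or in `[d − 1, N(N + d − 2)]`, independently of the lattice

HONEST FRAMING: exact (Metropolis-corrected) sampling algorithms for lattice gauge theory;
figures of merit are autocorrelation/cost numbers at stated couplings and volumes; no
continuum-physics claim.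

Venture `LatticeQCDFlow` (cell pub-lqcd), topic `Exactness`; FANOUT row 7 (`s0-cpn-null`: the
S0-D1 rung — 2D CP⁹, Lüscher's LO trivializing map inside HMC, Engel–Schaefer 2011).  NEW WORK of
the cell over the tree's `Exactness/LatticeSitePolynomialOperator.lean` (`polyLap N`: Lüscher's
`𝔏₀` as a linear endomorphism of `polyS N`; the labels `eigLabel`; triangularity
`polyLap_smonom_sub_smul`) and `Exactness/SphereLatticePoissonSolver.lean` (`𝔏₀` on the
spheres only sees the restriction); nothing is cited as a fact.  Printed counterpart, NAMED ONLY: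
M. Lüscher, Commun. Math. Phys. 293 (2010) 899, §3.3 (the Laplacian on the finite-dimensional
spaces `H_k` is symmetric, non-negative, with null space the constants) and §4.4 (each order of the
flow-action series is obtained by linear algebra in such a space); Engel–Schaefer, Comput. Phys.
Commun. 182 (2011) 2107, §3 (order `0`: eigenvalue `2(d−1) = 2(2N−1)`).  That the
Laplace–Beltrami operator of `S^{d−1}` has eigenvalues `ℓ(ℓ+d−2)` on spherical harmonics is
classical; here the lattice statement is obtained WITHOUT harmonic analysis, from the triangularity
of `𝔏₀` on site monomials (Euler's identity) alone.

## Content (`E` finite-dimensional, `d = dim E`; `Λ` finite; `Ω = S(E)^Λ`)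

* `labelFactor j = ∏_{κs : Fin j → SiteCoord} (X − C λ(κs))`, `annPoly N = ∏_{j ≤ N} labelFactor j`
  — a real polynomial whose roots are exactly the labels of the site monomials of degree `≤ N`
  (`eval_annPoly_eq_zero_iff`); `annPoly_split` (peel off one factor, keep `annPoly (k−2)`).
* **`aeval_annPoly_eq_zero`**: `annPoly N (𝔏) = 0` ON `polyS N` — strong induction on the degree:
  `(𝔏 − λ(m)) m` has degree `≤ k − 2` and is killed by `annPoly (k−2)(𝔏)`, a factor of the rest.
* **`exists_eigLabel_of_hasEigenvalue`**: every eigenvalue of `polyLap N` is a label of a monomial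
  of degree `≤ N`.
* `polyLap_sphere_congr` (`𝔏` on `Ω` only sees `f|_Ω`), `aeval_polyLap_apply_sphere_of_eigen`
  (on an `Ω`-eigenfunction, `p(𝔏) f = p(μ) f` on `Ω`).
* **`exists_eigLabel_of_sphere_eigenfunction`** — THE SPECTRUM OF `𝔏₀ = −Σ_k ∂̃_k·∂̃_k` ON THE
  LATTICE POLYNOMIALS: if `f ∈ polyS N` satisfies `−Σ_k ∂̃_k·∂̃_k f = μ f` on the product of unit
  spheres and does not vanish identically there, then `μ = Σ_n c_n (c_n + d − 2)` for the
  multidegree `(c_n)` of some site monomial of degree `≤ N`; **`sphere_eigenvalue_dichotomy`**: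
  hence `μ = 0` or `d − 1 ≤ μ ≤ N (N + d − 2)` (`d ≥ 2`) — A VOLUME-INDEPENDENT, COUPLING-FREE
  FINITE LIST OF RATES: the gap `d − 1` of `Exactness/SphereLatticePoincare` reappears
  algebraically on polynomial eigenfunctions, and the top of the spectrum at degree `N` is
  `N(N + d − 2)` (for the Engel–Schaefer series at order `k`, degree `2(k+1)`: `2(k+1)(2k+d)`).

NOT CLAIMED: that every label occurs (no eigenfunctions are constructed beyond the tree's orders
`0`, `1`); diagonalizability (tree: the `L²(π)`-symmetry of `𝔏₀`, `SphereLatticeGreen`, is not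
used here); anything about flows or numbers of the rung.
-/

noncomputable section

namespace Summit.Ventures.LatticeQCDFlow.Exactness

open Function Set Metric Polynomial
open scoped RealInnerProductSpace

variable {Λ : Type*} {E : Type*} [NormedAddCommGroup E] [InnerProductSpace ℝ E]
variable [Fintype Λ] [DecidableEq Λ]

/-! ## §1 The annihilating polynomial: its roots are the labels -/

section AnnPoly

variable (Λ E) in
/-- The degree-`j` factor `∏_{κs : Fin j → SiteCoord Λ E} (X − C λ(κs))` (one linear factor per
index family of a site monomial of degree `j`; repetitions allowed). -/
def labelFactor (j : ℕ) : ℝ[X] := ∏ κs : Fin j → SiteCoord Λ E, (X - C (eigLabel κs))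

variable (Λ E) in
/-- **The annihilating polynomial of `𝔏₀` on `polyS N`**: `∏_{j ≤ N} labelFactor j`. -/
def annPoly (N : ℕ) : ℝ[X] := ∏ j ∈ Finset.range (N + 1), labelFactor Λ E j

/-- **The roots of `annPoly N` are exactly the labels of the monomials of degree `≤ N`.** -/
theorem eval_annPoly_eq_zero_iff {N : ℕ} {μ : ℝ} :
    (annPoly Λ E N).eval μ = 0 ↔ ∃ k ≤ N, ∃ κs : Fin k → SiteCoord Λ E, μ = eigLabel κs := by
  simp only [annPoly, labelFactor, eval_prod, Finset.prod_eq_zero_iff, Finset.mem_range,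
    Finset.mem_univ, true_and, eval_sub, eval_X, eval_C, sub_eq_zero]
  constructor
  · rintro ⟨k, hk, κs, h⟩
    exact ⟨k, by omega, κs, h⟩
  · rintro ⟨k, hk, κs, h⟩
    exact ⟨k, by omega, κs, h⟩

/-- `annPoly j ∣ annPoly N` for `j ≤ N`. -/
theorem annPoly_dvd_of_le {j N : ℕ} (h : j ≤ N) : annPoly Λ E j ∣ annPoly Λ E N :=
  Finset.prod_dvd_prod_of_subset _ _ _ (Finset.range_subset_range.2 (by omega))

/-- Peeling one linear factor off `labelFactor j`. -/
theorem labelFactor_eq_mul {j : ℕ} (κs : Fin j → SiteCoord Λ E) :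
    labelFactor Λ E j =
      (∏ κs' ∈ Finset.univ.erase κs, (X - C (eigLabel κs'))) * (X - C (eigLabel κs)) :=
  (Finset.prod_erase_mul _ _ (Finset.mem_univ κs)).symm

/-- **Splitting the annihilating polynomial at a monomial of degree `k ≤ j`**:
`annPoly j = B · (X − λ(κs))` with `annPoly (k − 2) ∣ B` whenever `k ≥ 1` (the factors of the
degrees `≤ k − 2` are untouched). -/
theorem annPoly_split {j k : ℕ} (hkj : k ≤ j) (κs : Fin k → SiteCoord Λ E) :
    ∃ B : ℝ[X], annPoly Λ E j = B * (X - C (eigLabel κs)) ∧ (1 ≤ k → annPoly Λ E (k - 2) ∣ B) := by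
  refine ⟨(∏ k' ∈ (Finset.range (j + 1)).erase k, labelFactor Λ E k') *
      ∏ κs' ∈ Finset.univ.erase κs, (X - C (eigLabel κs')), ?_, fun hk1 => ?_⟩
  · rw [annPoly, ← Finset.prod_erase_mul (Finset.range (j + 1)) (fun k' => labelFactor Λ E k')
      (Finset.mem_range.2 (Nat.lt_succ_of_le hkj)), labelFactor_eq_mul κs, mul_assoc]
  · refine dvd_mul_of_dvd_left (Finset.prod_dvd_prod_of_subset _ _ _ fun x hx => ?_) _
    simp only [Finset.mem_range, Finset.mem_erase] at hx ⊢
    omega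

end AnnPoly

/-! ## §2 `annPoly N (𝔏) = 0` on `polyS N` -/

section Annihilate

variable [FiniteDimensional ℝ E]

/-- Divisibility transports annihilation: `q ∣ p`, `q(𝔏) v = 0 ⇒ p(𝔏) v = 0`. -/
theorem aeval_apply_eq_zero_of_dvd {N : ℕ} {p q : ℝ[X]} (hqp : q ∣ p) (v : polyS Λ E N)
    (hv : aeval (polyLap Λ E N) q v = 0) : aeval (polyLap Λ E N) p v = 0 := by
  obtain ⟨r, rfl⟩ := hqp
  rw [mul_comm, map_mul, Module.End.mul_apply, hv, map_zero]

/-- **THE INDUCTION**: for `j ≤ N`, `annPoly j (𝔏)` kills every member of `polyS N` of degree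
`≤ j` (strong induction on `j`, span induction on the monomials; the triangularity
`polyLap_smonom_sub_smul` lowers the degree by two). -/
theorem aeval_annPoly_apply_of_mem {N : ℕ} :
    ∀ j, j ≤ N → ∀ f : polyS Λ E N, (f : (Λ → E) → ℝ) ∈ polyS Λ E j →
      aeval (polyLap Λ E N) (annPoly Λ E j) f = 0 := by
  intro j
  induction j using Nat.strong_induction_on with
  | _ j ih =>
    intro hjN f hf
    suffices key : ∀ hg : (f : (Λ → E) → ℝ) ∈ polyS Λ E N,
        aeval (polyLap Λ E N) (annPoly Λ E j) ⟨(f : (Λ → E) → ℝ), hg⟩ = 0 from key f.2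
    refine Submodule.span_induction (p := fun g _ => ∀ hg : g ∈ polyS Λ E N,
      aeval (polyLap Λ E N) (annPoly Λ E j) ⟨g, hg⟩ = 0) ?_ ?_ ?_ ?_ hf
    · -- a site monomial of degree `k ≤ j`
      rintro _ ⟨⟨⟨k, hkj⟩, κs⟩, rfl⟩ hg
      have hkj' : k ≤ j := Nat.lt_succ_iff.1 hkj
      obtain ⟨B, hB, hdvd⟩ := annPoly_split (Λ := Λ) (E := E) hkj' κs
      rw [hB, map_mul, Module.End.mul_apply, map_sub, aeval_X, aeval_C, LinearMap.sub_apply,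
        Module.algebraMap_end_apply]
      rcases Nat.eq_zero_or_pos k with rfl | hkpos
      · -- the constant monomial: `𝔏 m = 0 = λ(m)`
        have h0 : polyLap Λ E N ⟨smonom κs, hg⟩ = 0 := polyLap_smonom_fin_zero κs
        rw [h0, eigLabel_fin_zero, zero_smul, sub_zero, map_zero]
      · -- degree `k ≥ 1`: `(𝔏 − λ) m` has degree `≤ k − 2`, killed by `annPoly (k−2) ∣ B`
        rw [polyLap_smonom_sub_smul (hkj'.trans hjN) κs, map_neg, neg_eq_zero]
        refine aeval_apply_eq_zero_of_dvd (hdvd hkpos) _ ?_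
        exact ih (k - 2) (by omega) (by omega) _ (sum_siteFlatLap_smonom_mem κs)
    · intro hg
      have e : (⟨0, hg⟩ : polyS Λ E N) = 0 := rfl
      rw [e, map_zero]
    · intro x y hx hy hpx hpy hg
      have hxN : x ∈ polyS Λ E N := polyS_mono hjN hx
      have hyN : y ∈ polyS Λ E N := polyS_mono hjN hy
      have e : (⟨x + y, hg⟩ : polyS Λ E N) = ⟨x, hxN⟩ + ⟨y, hyN⟩ := rfl
      rw [e, map_add, hpx hxN, hpy hyN, add_zero]
    · intro a x hx hpx hg
      have hxN : x ∈ polyS Λ E N := polyS_mono hjN hx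
      have e : (⟨a • x, hg⟩ : polyS Λ E N) = a • ⟨x, hxN⟩ := rfl
      rw [e, map_smul, hpx hxN, smul_zero]

/-- **`annPoly N (𝔏₀) = 0` ON THE LATTICE POLYNOMIALS OF DEGREE `≤ N`.** -/
theorem aeval_annPoly_eq_zero (N : ℕ) : aeval (polyLap Λ E N) (annPoly Λ E N) = 0 :=
  LinearMap.ext fun f => aeval_annPoly_apply_of_mem N le_rfl f f.2

/-- **EVERY EIGENVALUE OF `𝔏₀` ON `polyS N` IS A LABEL** `Σ_n c_n (c_n + d − 2)` of a site monomial
of degree `≤ N`. -/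
theorem exists_eigLabel_of_hasEigenvalue {N : ℕ} {μ : ℝ}
    (h : Module.End.HasEigenvalue (polyLap Λ E N) μ) :
    ∃ k ≤ N, ∃ κs : Fin k → SiteCoord Λ E, μ = eigLabel κs := by
  obtain ⟨v, hv⟩ := h.exists_hasEigenvector
  have h1 := Module.End.aeval_apply_of_hasEigenvector (p := annPoly Λ E N) hv
  rw [LinearMap.congr_fun (aeval_annPoly_eq_zero N) v, LinearMap.zero_apply] at h1
  exact eval_annPoly_eq_zero_iff.1 ((smul_eq_zero.1 h1.symm).resolve_right hv.2)

end Annihilate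

/-! ## §3 On the product of unit spheres -/

section Sphere

variable [FiniteDimensional ℝ E]

/-- **`𝔏₀` on `Ω` only sees the restriction**: members of `polyS N` that agree on the product of
unit spheres have the same `𝔏 ·` there. -/
theorem polyLap_sphere_congr {N : ℕ} {f g : polyS Λ E N}
    (h : ∀ ξ : Λ → sphere (0 : E) 1,
      (f : (Λ → E) → ℝ) (fun n => (ξ n : E)) = (g : (Λ → E) → ℝ) (fun n => (ξ n : E)))
    (ξ : Λ → sphere (0 : E) 1) :
    (polyLap Λ E N f : (Λ → E) → ℝ) (fun n => (ξ n : E)) =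
      (polyLap Λ E N g : (Λ → E) → ℝ) (fun n => (ξ n : E)) := by
  rw [polyLap_apply_sphere, polyLap_apply_sphere]
  have hg2 : ContDiff ℝ 2 (g : (Λ → E) → ℝ) := polyS_contDiff_two N _ g.2
  have hfg2 : ContDiff ℝ 2 ((f : (Λ → E) → ℝ) - (g : (Λ → E) → ℝ)) :=
    polyS_contDiff_two N _ ((polyS Λ E N).sub_mem f.2 g.2)
  have e : (f : (Λ → E) → ℝ) =
      fun x => (g : (Λ → E) → ℝ) x + ((f : (Λ → E) → ℝ) - (g : (Λ → E) → ℝ)) x := by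
    funext x; simp
  have h0 : ∀ ξ' : Λ → sphere (0 : E) 1,
      ((f : (Λ → E) → ℝ) - (g : (Λ → E) → ℝ)) (fun n => (ξ' n : E)) = 0 := fun ξ' => by
    simp [h ξ']
  rw [e, sum_siteLaplacian_add_sphereConfig hg2 hfg2 ξ,
    sum_siteLaplacian_sphereConfig_eq_zero_of_forall h0 ξ, add_zero]

/-- **Polynomial calculus on an `Ω`-eigenfunction**: if `𝔏 f = μ f` on the product of unit spheres
then `p(𝔏) f = p(μ) f` there, for every real polynomial `p`. -/
theorem aeval_polyLap_apply_sphere_of_eigen {N : ℕ} {f : polyS Λ E N} {μ : ℝ}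
    (hμ : ∀ ξ : Λ → sphere (0 : E) 1, (polyLap Λ E N f : (Λ → E) → ℝ) (fun n => (ξ n : E)) =
      μ * (f : (Λ → E) → ℝ) (fun n => (ξ n : E)))
    (p : ℝ[X]) (ξ : Λ → sphere (0 : E) 1) :
    (aeval (polyLap Λ E N) p f : (Λ → E) → ℝ) (fun n => (ξ n : E)) =
      p.eval μ * (f : (Λ → E) → ℝ) (fun n => (ξ n : E)) := by
  induction p using Polynomial.induction_on generalizing ξ with
  | C a =>
      rw [aeval_C, Module.algebraMap_end_apply, eval_C, Submodule.coe_smul, Pi.smul_apply,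
        smul_eq_mul]
  | add p q hp hq =>
      rw [map_add, LinearMap.add_apply, Submodule.coe_add, Pi.add_apply, hp ξ, hq ξ, eval_add,
        add_mul]
  | monomial n a h =>
      have e : C a * X ^ (n + 1) = X * (C a * X ^ n) := by ring
      rw [e, map_mul, Module.End.mul_apply, aeval_X, eval_mul, eval_X]
      have hg : ∀ ξ' : Λ → sphere (0 : E) 1,
          (aeval (polyLap Λ E N) (C a * X ^ n) f : (Λ → E) → ℝ) (fun m => (ξ' m : E)) =
            (((C a * X ^ n).eval μ • f : polyS Λ E N) : (Λ → E) → ℝ) (fun m => (ξ' m : E)) :=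
        fun ξ' => by rw [h ξ', Submodule.coe_smul, Pi.smul_apply, smul_eq_mul]
      rw [polyLap_sphere_congr hg ξ, map_smul, Submodule.coe_smul, Pi.smul_apply, smul_eq_mul,
        hμ ξ]
      ring

/-- **THE SPECTRUM OF LÜSCHER'S OPERATOR ON THE LATTICE POLYNOMIALS.**  If a lattice polynomial
`f` of degree `≤ N` satisfies `−Σ_k ∂̃_k·∂̃_k f = μ·f` on the product of unit spheres `S(E)^Λ` and
does not vanish identically there, then `μ = Σ_n c_n (c_n + d − 2)` (`d = dim E`) for the site
counts `(c_n)` of some site monomial of degree `≤ N`. -/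
theorem exists_eigLabel_of_sphere_eigenfunction (N : ℕ) {f : (Λ → E) → ℝ} (hf : f ∈ polyS Λ E N)
    {μ : ℝ} (hμ : ∀ ξ : Λ → sphere (0 : E) 1,
      -∑ k, siteLaplacian k f (fun n => (ξ n : E)) = μ * f (fun n => (ξ n : E)))
    (hne : ∃ ξ : Λ → sphere (0 : E) 1, f (fun n => (ξ n : E)) ≠ 0) :
    ∃ k ≤ N, ∃ κs : Fin k → SiteCoord Λ E, μ = eigLabel κs := by
  obtain ⟨ξ₀, h0⟩ := hne
  have hμ' : ∀ ξ : Λ → sphere (0 : E) 1,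
      (polyLap Λ E N ⟨f, hf⟩ : (Λ → E) → ℝ) (fun n => (ξ n : E)) =
        μ * ((⟨f, hf⟩ : polyS Λ E N) : (Λ → E) → ℝ) (fun n => (ξ n : E)) := fun ξ => by
    rw [polyLap_apply_sphere]; exact hμ ξ
  have h1 := aeval_polyLap_apply_sphere_of_eigen hμ' (annPoly Λ E N) ξ₀
  rw [LinearMap.congr_fun (aeval_annPoly_eq_zero N) ⟨f, hf⟩, LinearMap.zero_apply,
    Submodule.coe_zero, Pi.zero_apply] at h1
  exact eval_annPoly_eq_zero_iff.1 ((mul_eq_zero.1 h1.symm).resolve_right h0)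

/-- **COROLLARY (volume-independent spectral bounds).**  Under the same hypotheses, with `d ≥ 2`:
`μ = 0`, or `d − 1 ≤ μ ≤ N (N + d − 2)` — the list of possible rates depends on the degree and on
`d` only, not on `Λ`. -/
theorem sphere_eigenvalue_dichotomy (h2 : 2 ≤ Module.finrank ℝ E) (N : ℕ) {f : (Λ → E) → ℝ}
    (hf : f ∈ polyS Λ E N) {μ : ℝ}
    (hμ : ∀ ξ : Λ → sphere (0 : E) 1,
      -∑ k, siteLaplacian k f (fun n => (ξ n : E)) = μ * f (fun n => (ξ n : E)))
    (hne : ∃ ξ : Λ → sphere (0 : E) 1, f (fun n => (ξ n : E)) ≠ 0) :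
    μ = 0 ∨ ((Module.finrank ℝ E : ℝ) - 1 ≤ μ ∧
      μ ≤ (N : ℝ) * (N + (Module.finrank ℝ E : ℝ) - 2)) := by
  obtain ⟨k, hk, κs, rfl⟩ := exists_eigLabel_of_sphere_eigenfunction N hf hμ hne
  rcases Nat.eq_zero_or_pos k with rfl | hkpos
  · exact Or.inl (eigLabel_fin_zero κs)
  · exact Or.inr ⟨le_eigLabel (by omega) hkpos κs, eigLabel_le_of_le (by omega) hk κs⟩

/-- **A nonzero eigenvalue is at least `d − 1`** (the spectral gap of
`Exactness/SphereLatticePoincare`, recovered algebraically on polynomial eigenfunctions) **and at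
most `N (N + d − 2)`**. -/
theorem sphere_eigenvalue_bounds_of_ne_zero (h2 : 2 ≤ Module.finrank ℝ E) (N : ℕ)
    {f : (Λ → E) → ℝ} (hf : f ∈ polyS Λ E N) {μ : ℝ} (hμ0 : μ ≠ 0)
    (hμ : ∀ ξ : Λ → sphere (0 : E) 1,
      -∑ k, siteLaplacian k f (fun n => (ξ n : E)) = μ * f (fun n => (ξ n : E)))
    (hne : ∃ ξ : Λ → sphere (0 : E) 1, f (fun n => (ξ n : E)) ≠ 0) :
    (Module.finrank ℝ E : ℝ) - 1 ≤ μ ∧ μ ≤ (N : ℝ) * (N + (Module.finrank ℝ E : ℝ) - 2) :=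
  (sphere_eigenvalue_dichotomy h2 N hf hμ hne).resolve_left hμ0

end Sphere

end Summit.Ventures.LatticeQCDFlow.Exactness

end
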